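import Literature.MathematicalPhysics.QuantumFieldTheory.MullerSchiemann1987.MS87HeatKernelGroup
import Literature.MathematicalPhysics.QuantumFieldTheory.Balaban1983to89.T4HaarSU2ExpChart
import Literature.MathematicalPhysics.QuantumFieldTheory.StrongCouplingActivities
import Literature.Analysis.FunctionSpaces.BesselIIntegralSeries
import Literature.Probability.LatticeModels.BesselIDebyeAsymptotics
import HarnessLib

/-!
# Müller–Schiemann, *Continuum limit of a hierarchical SU(2) lattice gauge theory in 4 dimensions*
# (CMP 110, 1987), Sect. 5 «Inductive Reproduction of the Nonperturbative Bound» (pp. 275–277):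
# the decomposition (5.10)–(5.14), the `SU(2)` class-function integral and the Bessel function `I₁`
# behind (5.17), «x⁻¹I₁(x) increases monotonously», (5.18)–(5.19) exactly, and the exponent
# collection (5.21)–(5.23) ⟹ (5.24) ⟹ (5.25) — PROVED (model-free where the print is; constants explicit)

statement-level skeleton of published theorems with citation tags; proofs where landed; nothing here is a claim about the Yang–Mills mass gap

**Citation header (reproduction of PUBLISHED work).** V. F. Müller, J. Schiemann, *Continuum limit of a hierarchical
SU(2) lattice gauge theory in 4 dimensions*, Commun. Math. Phys. **110** (1987) 261–286, doi 10.1007/BF01207367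
[MullerSchiemann1987], Sect. 5, journal pp. 275–277 (held Project Euclid scan `paper:url-96df5da18d4c`, PDF page =
journal page − 260; the displays (5.1)–(5.25) were read by this seat on its own 3× page renders
`run/shared/lean/pub/lit-balaban/lit-balaban-p12/renders-cmp110ms/ms87-cmp110-pdfp015…017-journalp275…277-x3.png`).
This file is the Lean lane of the lit-balaban YM LIT SWEEP CONTEXT row X1 (register level; zero weight for any token of
that table): the model is the `d = 4` HIERARCHICAL `SU(2)` gauge model (Migdal's recursion as an exact renormalization
group), NOT lattice Yang–Mills.  Sect. 5 is the LARGE-FIELD half of the inductive step of THEOREM 1 (p.267): the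
reproduction, after one Migdal step (3.1) = (5.1)–(5.3), of the nonperturbative bound
(A₂) `|g̃(u, iy)| < exp{βy² − pβ^{1−2α}}` for `u` «far from the unit element» (p.267).

**What the paper prints (verbatim; displays image-read on pp. 275–277).**
* (5.1)–(5.4) p.275: *«From (3.1) we have the recursion relation g̃′(u,iy) = {J(u,iy)/M}² (5.1) with the convolutions
  J(u,iy) = ∫dv g̃(uv⁻¹, (i/2)y) g̃(v, (i/2)y) (5.2), M = ∫dv[g(v)]² (5.3). In order to reproduce the bound (A₂) for g̃′
  we have to consider y ∈ ℝ, |y| < (κ/2)(β′)^{−α}, u ∈ G∖𝒢[iy,(β′)^{−α}]. (5.4)»*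
* (5.5) p.276: *«From the assumptions (A₂) and (A₃) we can easily deduce M = const β^{−3/2}{1 + 𝒪(β^{1−4α})}.»*
* (5.6)–(5.14) p.276: the characteristic functions `χ₁ := χ(uv⁻¹; (i/2)y, β^{−α})`, `χ₂ := χ(v; (i/2)y, β^{−α})`, the
  central angles `θ₁² := θ²(uv⁻¹, (i/2)y)`, `θ₂² := θ²(v, (i/2)y)`, and *«we decompose (5.2) as follows:
  J(u,iy) = Σ_{k=1}^4 J^{(k)} (5.10), J^{(1)} := ∫dv χ₁χ₂ h(θ₁)h(θ₂) (5.11), J^{(2)} := ∫dv (1−χ₁)χ₂ g̃(uv⁻¹,(i/2)y)h(θ₂)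
  (5.12), J^{(3)} := ∫dv χ₁(1−χ₂)h(θ₁)g̃(v,(i/2)y) (5.13), J^{(4)} := ∫dv (1−χ₁)(1−χ₂)g̃(uv⁻¹,(i/2)y)g̃(v,(i/2)y) (5.14).
  In writing this decomposition we used in the small field region |θ²| < β^{−2α} the representation for g̃ given in
  Proposition 1. In this region we can use (4.53).»*
* (5.15)–(5.17) p.276: *«Re θ₁² = 2[1 − (uv⁻¹)₀] − ¼y² + 𝒪(β^{−4α}) (5.15), Re θ₂² = 2[1 − v₀] − ¼y² + 𝒪(β^{−4α}) (5.16).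
  … With (4.53) and (5.15), (5.16) follows for J^{(1)},
  |J^{(1)}| < exp{(β/2)y² + 𝒪(β^{1−4α})} ∫dv χ₁χ₂ exp{−2β[2 − (uv⁻¹)₀ − v₀]}
          < exp{(β/2)y² + 𝒪(β^{1−4α})} ∫dv exp{−β[4 − trace(uv⁻¹) − trace v]}
          < const exp{(β/2)y² − 4β} I₁(2β√(2(1+u₀)))/(β√(2(1+u₀))), (5.17)
  where I₁ is the modified Bessel function.»*
* p.277 L.1–3: *«Since x⁻¹I₁(x) increases monotonously with x ∈ ℝ₊, we can in (5.17) replace u₀ by sup(u₀) compatible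
  with the region (5.4). It is found on the boundary»* (5.18) *«(β′)^{−2α} = |θ²(u,iy)| = |2(1−u₀) − y² − 2iyu₃| +
  𝒪((β′)^{−4α})»* *«for (u₃)² = 1 − (u₀)². With the ansatz u₀ = cos ψ, ψ = 𝒪(β^{−α}), we obtain»* (5.19)
  *«(β′)^{−4α} = (ψ² + y²)² + 𝒪(β^{−6α}), and hence»* (5.20) *«sup(u₀) = 1 − ½{(β′)^{−2α} − y²} + 𝒪(β^{−4α}).»*
* (5.21)–(5.23) p.277: *«Employing the asymptotic expansion of the modified Bessel function in (5.17) and using (5.20)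
  together with the maximal value of |y| due to (5.4) finally yields the bound
  |J^{(1)}| < const β^{−3/2} exp{(β/2)[y² − p(β′)^{−2α} − (1 − κ²/4 − p)(β′)^{−2α}]} (5.21). … we obtain the bounds
  |J^{(2)}|, |J^{(3)}| < … < exp{½β[y² − pβ^{−2α} − pβ^{−2α} + 𝒪(β^{−4α})]} (5.22). A bound on J^{(4)} follows directly
  from the induction assumption (A₂), |J^{(4)}| < exp{½β[y² − pβ^{−2α} − 3pβ^{−2α}]} (5.23).»*
* (5.24)–(5.25) p.277: *«Collecting these bounds (5.21)–(5.23) and incorporating there β′ = β + 𝒪(1), we deduce from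
  the decomposition (5.10), |J(u,iy)| < const exp{½[β′y² − p(β′)^{1−2α} − δ₃(β′)^{1−2α}]} (5.24) with
  δ₃ = min{p, 1 − κ²/4 − p} = 1 − κ²/4 − p. Hence due to δ₃ > 0 and β′ sufficiently large, (5.24) and (5.5) imply for
  the analytically continued Gibbs factor (5.1) the bound |g̃′(u,iy)| < exp{β′y² − p(β′)^{1−2α}}, (5.25) valid in the
  domain (5.4). Thus we have reproduced the induction assumption (A₂) after one iteration, which concludes the proof of
  Theorem 1.»*  The standing parameters: (A₂) p.267 «1 < κ < 1 + ε (ε > 0 small) and ½ < p < 1 − κ²/4»; p.278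
  «3/7 ≤ α < ½».

**What this file proves (kernel-checked, 0 sorry, standard axioms; no new definition of the model, no named fact).**
* §1 **(5.10)–(5.14)** `eq510`: on any measure space, for kernels `g₁, g₂` with small-field representatives `h₁, h₂`
  (`χ_j g_j = χ_j h_j`, which is Proposition 1 used «in the small field region») the integral of `g₁g₂` is the sum of
  the four printed integrals (pointwise identity `integrand_decomp` + linearity; the same algebra gives (4.48)–(4.52)).
* §2 **THE `SU(2)` INTEGRAL OF (5.17)** — Weyl's integration formula for class functions of `G = SU(2)`:
  `∫_G F(v₀) dv = (2/π)∫₀^π F(cos θ) sin²θ dθ` (`integral_comp_u0`, from the tree's exponential-chart Haar density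
  `T4HaarSU2ExpChart.integral_haarProbability_su2_exp` and radial integration), right translation invariance
  `∫ F((vw⁻¹)₀) dv = ∫ F(v₀) dv` (`integral_comp_u0_mul_inv`); the quaternionic identity behind «trace(uv⁻¹) + trace v»:
  `(uv⁻¹)₀ + v₀ = ρ(u)·(vw⁻¹)₀` with `ρ(u) = |q_u + 1| = √(2(1+u₀))` (`u0_mul_inv_add_u0_eq`, `norm_su2Quat_add_one_eq`;
  `tr u = 2u₀` is `HeatKernel.trace_val_eq`); and **(5.17), second ⟶ third line, AS AN IDENTITY**:
  `∫_G exp{−β[4 − 2(uv⁻¹)₀ − 2v₀]} dv = e^{−4β} · I₁(2βρ)/(βρ)`, `ρ = √(2(1+u₀)) > 0` (`eq517`; print's «const»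
  is `1` here).
* §3 **THE BESSEL FUNCTION**: with the tree's `besselI 1 x = π⁻¹∫₀^π e^{x cos θ} cos θ dθ` (DLMF 10.32.3),
  `I₁(x) = (x/π)∫₀^π e^{x cos θ} sin²θ dθ` (`besselI_one_eq`, integration by parts), the Weyl-side identity
  `(2/π)∫₀^π sin²θ e^{c cos θ} dθ = 2I₁(c)/c` (`weyl_exp_eq_besselI`), **p.277 L.1–2 «x⁻¹I₁(x) increases monotonously
  with x ∈ ℝ₊»** (`monotoneOn_besselI_one_div`, via `∫₀^π e^{x cos θ}sin²θ dθ = ∫₀^π cosh(x cos θ) sin²θ dθ`), the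
  replacement `u₀ ↦ sup u₀` it licenses (`eq517_mono`: `ρ ≤ ρ̄ ⟹ I₁(2βρ)/(βρ) ≤ I₁(2βρ̄)/(βρ̄)`), and «the asymptotic
  expansion of the modified Bessel function» in the form used for the `β^{−3/2}` of (5.21):
  `I₁(x) ≤ (1 + 50/x)e^x/√(2πx)` (`besselI_one_le_envelope`, from the tree's Debye envelope of `I₀` and `I₁ ≤ I₀`).
* §4 **(5.18)–(5.21)**: the modulus in (5.18) computed exactly, `|2(1−cos ψ) − y² − 2iy sin ψ|² = (2(1−cos ψ) + y²)² −
  4y²(1−cos ψ)²` (`eq519_exact`; with `2(1−cos ψ) = ψ² + 𝒪(ψ⁴)` this is (5.19)); `√(4 − ε) ≤ 2 − ε/4`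
  (`sqrt_four_sub_le`) and the exponent algebra of (5.20) ⟶ (5.21): `2(1 + ū₀) = 4 − (β′^{−2α} − y² − 2r)` gives
  `−4β + 2βρ̄ ≤ −(β/2)(β′^{−2α} − y² − 2r)`, and with `y² ≤ (κ²/4)β′^{−2α}` ((5.4)) the exponent of (5.21)
  up to `+βr` (`eq521_exponent`).
* §5 **(5.21)–(5.23) ⟹ (5.24)** `eq524`: for `¼ ≤ α < ½`, `½ < p < 1 − κ²/4` (`δ₃ := 1 − κ²/4 − p > 0`), `β, β′ ≥ 1`,
  `|β − β′| ≤ c` (print's «β′ = β + 𝒪(1)», `c ≥ 1`), `y² ≤ (κ/2)²β′^{−2α}` ((5.4)) and the printed bounds (5.21), (5.22)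
  (with `𝒪(β^{−4α})` read as `+ Dβ^{−4α}`, `D ≥ 0`), (5.23) on `‖J⁽ᵏ⁾‖`:
  `‖J‖ ≤ (C₁ + 3)·exp{cκ²/8 + 2pc + D/2}·exp{½[β′y² − pβ′^{1−2α} − δ₃β′^{1−2α}]}` — (5.24) with an EXPLICIT const;
  **(5.24) + (5.5) ⟹ (5.25)** `eq525`: with `M ≥ mβ^{−3/2}` (`m > 0`, the lower half of (5.5)) and `g̃′ = (J/M)²` ((5.1)),
  for all sufficiently large `β′` (Mathlib `∀ᶠ β′ in atTop`; «due to δ₃ > 0 and β′ sufficiently large»; `log β′ =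
  o(β′^{1−2α})`), `‖(J/M)²‖ < exp{β′y² − pβ′^{1−2α}}`.

**Departures / readings (declared).** (i) The Gibbs factor `g̃`, the regions `𝒢[z, ϱ]`, `χ`, `θ²` and Proposition 1 are
NOT re-modelled here (they live in `MS87HeatKernelGroup` / `MS87CentralAngle`); §1 takes «χ_j g̃_j = χ_j h(θ_j)» as the
hypothesis it is, §5 takes the displayed bounds (5.21)–(5.23), (5.5) as hypotheses, exactly as the print collects them.
(ii) `𝒪(β^{−4α})` in (5.22) is read as a term `Dβ^{−4α}` with a constant `D ≥ 0`; `𝒪(1)` in «β′ = β + 𝒪(1)» as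
`|β − β′| ≤ c`; «const» in (5.21) as `C₁ ≥ 0`; (5.5) is used only through `M ≥ mβ^{−3/2}`.  (iii) `α ≥ ¼` (print:
`3/7 ≤ α`) is exactly what makes `β^{1−4α} ≤ 1`, i.e. the `𝒪(β^{1−4α})` terms `𝒪(1)`; `κ > 1` is not needed for
(5.24)–(5.25) and not assumed there.  (iv) In (5.17) the equality `∫dv exp{−β[4 − tr(uv⁻¹) − tr v]} = e^{−4β}I₁(2βρ)/(βρ)`
is proved for `ρ > 0` (`u ≠ −e₀`); print's strict `<` signs are `≤`/`=` here.  (v) (5.19)'s `𝒪(β^{−6α})` and (5.20)'s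
`𝒪(β^{−4α})` are not re-derived: `eq519_exact` is the exact identity of which (5.19) is the Taylor truncation, and
`eq521_exponent` carries (5.20)'s remainder as a letter `r`.

**Not claimed.** (A₂)/(A₃) themselves, (4.53), (5.5), (5.15)–(5.16), the first inequality of (5.17) and (5.22)–(5.23)
(they are the induction hypotheses / Sect. 4 inputs and enter §5 as hypotheses); Theorem 1; anything about lattice
Yang–Mills or the Clay problem.
-/

open MeasureTheory Set Metric Filter Topology Asymptotics
open scoped Quaternion
open Literature.MathematicalPhysics.QuantumFieldTheory (haarProbability)
open Literature.MathematicalPhysics.QuantumLattice (su2Quat quatMatrix quatToSU2 norm_su2Quat normSq_su2Quat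
  su2Quat_ne_zero)
open Literature.MathematicalPhysics.QuantumFieldTheory.Balaban1983to89.T4HaarSU2Translate
  (su2Quat_mul su2Quat_one su2Quat_quatToSU2)
open Literature.MathematicalPhysics.QuantumFieldTheory.Balaban1983to89.T4HaarSU2ExpChart
  (expPoint expWeight su2Quat_expPoint exp_imQuat_re integral_haarProbability_su2_exp)
open Literature.Analysis.FunctionSpaces (besselI)

namespace Literature.MathematicalPhysics.QuantumFieldTheory

namespace MullerSchiemann1987

namespace NonperturbativeBound

/-! ## §1 The decomposition (5.10)–(5.14) -/

section Decomposition

variable {V : Type*} [MeasurableSpace V] (μ : Measure V)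

/-- The pointwise identity under (5.10)–(5.14) (and (4.48)–(4.52)): if `χ₁g₁ = χ₁h₁` and `χ₂g₂ = χ₂h₂` («in the
small field region … the representation for g̃ given in Proposition 1»), then
`g₁g₂ = χ₁χ₂h₁h₂ + (1−χ₁)χ₂g₁h₂ + χ₁(1−χ₂)h₁g₂ + (1−χ₁)(1−χ₂)g₁g₂`. [cite: MullerSchiemann1987, (5.10)–(5.14) p.276] -/
theorem integrand_decomp {χ₁ χ₂ g₁ g₂ h₁ h₂ : ℂ} (e₁ : χ₁ * g₁ = χ₁ * h₁) (e₂ : χ₂ * g₂ = χ₂ * h₂) :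
    g₁ * g₂ = χ₁ * χ₂ * h₁ * h₂ + (1 - χ₁) * χ₂ * g₁ * h₂ + χ₁ * (1 - χ₂) * h₁ * g₂ +
      (1 - χ₁) * (1 - χ₂) * g₁ * g₂ := by
  linear_combination (g₂ - χ₂ * (g₂ - h₂)) * e₁ + g₁ * e₂

/-- **(5.10)–(5.14): `J(u,iy) = Σ_{k=1}^4 J^{(k)}`** — with `g₁(v) = g̃(uv⁻¹,(i/2)y)`, `g₂(v) = g̃(v,(i/2)y)`,
`h_j = h(θ_j)` and the cut-offs `χ₁, χ₂` of (5.6)–(5.7): `∫ g₁g₂ = J⁽¹⁾ + J⁽²⁾ + J⁽³⁾ + J⁽⁴⁾` with the printed integrands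
(5.11)–(5.14), for any measure (here: Haar measure `dv` on `G`), given `χ_j g_j = χ_j h_j` pointwise and integrability
of the four products. [cite: MullerSchiemann1987, (5.10)–(5.14) p.276] -/
theorem eq510 {χ₁ χ₂ g₁ g₂ h₁ h₂ : V → ℂ} (e₁ : ∀ v, χ₁ v * g₁ v = χ₁ v * h₁ v)
    (e₂ : ∀ v, χ₂ v * g₂ v = χ₂ v * h₂ v)
    (i₁ : Integrable (fun v => χ₁ v * χ₂ v * h₁ v * h₂ v) μ)
    (i₂ : Integrable (fun v => (1 - χ₁ v) * χ₂ v * g₁ v * h₂ v) μ)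
    (i₃ : Integrable (fun v => χ₁ v * (1 - χ₂ v) * h₁ v * g₂ v) μ)
    (i₄ : Integrable (fun v => (1 - χ₁ v) * (1 - χ₂ v) * g₁ v * g₂ v) μ) :
    ∫ v, g₁ v * g₂ v ∂μ =
      (∫ v, χ₁ v * χ₂ v * h₁ v * h₂ v ∂μ) + (∫ v, (1 - χ₁ v) * χ₂ v * g₁ v * h₂ v ∂μ) +
        (∫ v, χ₁ v * (1 - χ₂ v) * h₁ v * g₂ v ∂μ) + ∫ v, (1 - χ₁ v) * (1 - χ₂ v) * g₁ v * g₂ v ∂μ := by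
  have hfun : (fun v => g₁ v * g₂ v) = fun v =>
      ((χ₁ v * χ₂ v * h₁ v * h₂ v + (1 - χ₁ v) * χ₂ v * g₁ v * h₂ v) + χ₁ v * (1 - χ₂ v) * h₁ v * g₂ v) +
        (1 - χ₁ v) * (1 - χ₂ v) * g₁ v * g₂ v :=
    funext fun v => integrand_decomp (e₁ v) (e₂ v)
  have i12 : Integrable (fun v => χ₁ v * χ₂ v * h₁ v * h₂ v + (1 - χ₁ v) * χ₂ v * g₁ v * h₂ v) μ := i₁.add i₂
  have i123 : Integrable (fun v => (χ₁ v * χ₂ v * h₁ v * h₂ v + (1 - χ₁ v) * χ₂ v * g₁ v * h₂ v) +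
      χ₁ v * (1 - χ₂ v) * h₁ v * g₂ v) μ := i12.add i₃
  rw [hfun, integral_add i123 i₄, integral_add i12 i₃, integral_add i₁ i₂]

end Decomposition

/-! ## §2 `G = SU(2)`: the class-function integral behind (5.17) -/

section OnSU2

/-- The group `G = SU(2)` as Mathlib's special unitary `2 × 2` complex matrices (file-local shorthand, as in the
sibling `MullerSchiemann1987` files). -/
local notation "SU2" => Matrix.specialUnitaryGroup (Fin 2) ℂ

open HeatKernel (u0 u3 continuous_u0 u0_inv trace_val_eq)

/-- `u₀ = Re u₀₀` is the real part of the unit quaternion `q_u` of `u` (the tree's `QuantumLattice.su2Quat`).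
[cite: MullerSchiemann1987, p.264 L.28–30] -/
theorem u0_eq_re_su2Quat (U : SU2) : u0 U = (su2Quat U).re := rfl

/-- In the exponential chart `x ↦ exp(ιx)` of `SU(2)`, `u₀(exp ιx) = cos‖x‖` (the central angle is `‖x‖`).
[cite: MullerSchiemann1987, (2.17) p.265] -/
theorem u0_expPoint (x : EuclideanSpace ℝ (Fin 3)) : u0 (expPoint x) = Real.cos ‖x‖ := by
  rw [u0_eq_re_su2Quat, su2Quat_expPoint, exp_imQuat_re]

/-- The unit ball of `ℝ³` has volume `4π/3`, as a real number. [folklore] -/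
private theorem volume_real_unitBall_three :
    (volume : Measure (EuclideanSpace ℝ (Fin 3))).real (ball 0 1) = 4 * Real.pi / 3 := by
  rw [measureReal_def, EuclideanSpace.volume_ball_fin_three]
  rw [ENNReal.toReal_mul, ← ENNReal.ofReal_pow zero_le_one, one_pow, ENNReal.toReal_ofReal zero_le_one,
    ENNReal.toReal_ofReal (by positivity)]
  ring

/-- **WEYL'S INTEGRATION FORMULA FOR CLASS FUNCTIONS OF `SU(2)`** (the step «∫dv exp{−β[4 − trace(uv⁻¹) − trace v]}
↦ Bessel function» of (5.17) rests on it): for continuous `F`,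
`∫_{SU(2)} F(v₀) dv = (2/π) ∫₀^π F(cos θ) sin²θ dθ` (normalised Haar measure; `v₀ = ½ tr v = cos θ(v)`).  Proof: the
tree's exponential-chart formula `dv = (2π²)⁻¹ sinc²‖x‖ d³x` on `‖x‖ < π` and radial integration in `ℝ³`.
[cite: MullerSchiemann1987, (5.17) p.276] -/
theorem integral_comp_u0 (F : ℝ → ℝ) (hF : Continuous F) :
    ∫ U, F (u0 U) ∂(haarProbability SU2) =
      2 / Real.pi * ∫ θ in (0:ℝ)..Real.pi, Real.sin θ ^ 2 * F (Real.cos θ) := by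
  have hmeas : AEStronglyMeasurable (fun U : SU2 => F (u0 U)) (haarProbability SU2) :=
    (hF.comp continuous_u0).aestronglyMeasurable
  rw [integral_haarProbability_su2_exp _ hmeas]
  simp only [u0_expPoint, smul_eq_mul]
  rw [← integral_indicator measurableSet_ball]
  set g : ℝ → ℝ := (Iio Real.pi).indicator fun r => (2 * Real.pi ^ 2)⁻¹ * Real.sinc r ^ 2 * F (Real.cos r) with hg
  have h1 : (fun x : EuclideanSpace ℝ (Fin 3) => (ball (0 : EuclideanSpace ℝ (Fin 3)) Real.pi).indicator
      (fun x => expWeight x * F (Real.cos ‖x‖)) x) = fun x => g ‖x‖ := by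
    funext x
    by_cases h : ‖x‖ < Real.pi
    · rw [indicator_of_mem (mem_ball_zero_iff.mpr h), hg, indicator_of_mem (show ‖x‖ ∈ Iio Real.pi from h),
        expWeight]
    · rw [indicator_of_notMem (fun h' => h (mem_ball_zero_iff.mp h')), hg,
        indicator_of_notMem (show ‖x‖ ∉ Iio Real.pi from h)]
  rw [h1, MeasureTheory.integral_fun_norm_addHaar volume g, finrank_euclideanSpace_fin,
    volume_real_unitBall_three]
  simp only [smul_eq_mul, nsmul_eq_mul]
  have hrad : ∫ y in Ioi (0:ℝ), y ^ (3 - 1) * g y =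
      (2 * Real.pi ^ 2)⁻¹ * ∫ θ in (0:ℝ)..Real.pi, Real.sin θ ^ 2 * F (Real.cos θ) := by
    have hpt : ∀ y ∈ Ioi (0:ℝ), y ^ (3 - 1) * g y =
        (Iio Real.pi).indicator (fun t => (2 * Real.pi ^ 2)⁻¹ * (Real.sin t ^ 2 * F (Real.cos t))) y := by
      intro y hy
      have hy0 : (0:ℝ) < y := hy
      by_cases h : y < Real.pi
      · rw [hg, indicator_of_mem (show y ∈ Iio Real.pi from h), indicator_of_mem (show y ∈ Iio Real.pi from h)]
        have := Balaban1983to89.T4HaarSU2ExpChart.sq_mul_sinc_sq hy0.ne'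
        calc y ^ (3 - 1) * ((2 * Real.pi ^ 2)⁻¹ * Real.sinc y ^ 2 * F (Real.cos y))
            = (2 * Real.pi ^ 2)⁻¹ * ((y ^ 2 * Real.sinc y ^ 2) * F (Real.cos y)) := by ring
          _ = _ := by rw [this]
      · rw [hg, indicator_of_notMem (show y ∉ Iio Real.pi from h),
          indicator_of_notMem (show y ∉ Iio Real.pi from h), mul_zero]
    rw [setIntegral_congr_fun measurableSet_Ioi hpt, setIntegral_indicator measurableSet_Iio,
      show Ioi (0 : ℝ) ∩ Iio Real.pi = Ioo 0 Real.pi from rfl, integral_const_mul,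
      ← integral_Ioc_eq_integral_Ioo, ← intervalIntegral.integral_of_le Real.pi_pos.le]
  rw [hrad]
  field_simp
  ring

/-- **Right-translation invariance**: `∫ F((vw⁻¹)₀) dv = ∫ F(v₀) dv` (unimodularity of the compact group; used to
remove the direction `w` of `u + e₀` in (5.17)). [cite: MullerSchiemann1987, (5.17) p.276] -/
theorem integral_comp_u0_mul_inv (F : ℝ → ℝ) (w : SU2) :
    ∫ U, F (u0 (U * w⁻¹)) ∂(haarProbability SU2) = ∫ U, F (u0 U) ∂(haarProbability SU2) := by
  have h := integral_haar_conj_eq (G := SU2) (fun U => F (u0 U)) 1 w⁻¹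
  simpa only [one_mul] using h

/-- On `SU(2)` the quaternion of the inverse is the conjugate quaternion (as in the tree's
`T4WilsonLinkAffine.su2Quat_inv`, re-proved here to keep the import closure small). [folklore] -/
private theorem su2Quat_inv (U : SU2) : su2Quat U⁻¹ = star (su2Quat U) := by
  have h1 : su2Quat U⁻¹ * su2Quat U = 1 := by rw [← su2Quat_mul, inv_mul_cancel, su2Quat_one]
  have hn : Quaternion.normSq (su2Quat U) = 1 := normSq_su2Quat U
  have h2 : star (su2Quat U) * su2Quat U = 1 := by
    rw [Quaternion.star_mul_self, hn, Quaternion.coe_one]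
  exact mul_right_cancel₀ (su2Quat_ne_zero U) (h1.trans h2.symm)

/-- `(uv⁻¹)₀ = Re(q_u q̄_v)` (`= ⟨q_u, q_v⟩_{ℝ⁴}`). [cite: MullerSchiemann1987, (5.15) p.276] -/
theorem u0_mul_inv (u v : SU2) : u0 (u * v⁻¹) = (su2Quat u * star (su2Quat v)).re := by
  rw [u0_eq_re_su2Quat, su2Quat_mul, su2Quat_inv]

/-- `(uv⁻¹)₀ + v₀ = Re((q_u + 1) q̄_v)`: the exponent «−β[4 − trace(uv⁻¹) − trace v]» of (5.17) depends on `v` only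
through the inner product with `q_u + 1 = q_u + q_{e₀}`. [cite: MullerSchiemann1987, (5.17) p.276] -/
theorem u0_mul_inv_add_u0 (u v : SU2) :
    u0 (u * v⁻¹) + u0 v = ((su2Quat u + 1) * star (su2Quat v)).re := by
  rw [u0_mul_inv, add_mul, one_mul, Quaternion.re_add, Quaternion.re_star, u0_eq_re_su2Quat]

/-- `|q_u + 1|² = 2(1 + u₀)` — the square of print's `√(2(1+u₀))`. [cite: MullerSchiemann1987, (5.17) p.276] -/
theorem norm_su2Quat_add_one_sq (u : SU2) : ‖su2Quat u + 1‖ ^ 2 = 2 * (1 + u0 u) := by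
  rw [sq, ← Quaternion.normSq_eq_norm_mul_self, Quaternion.normSq_def']
  have h := normSq_su2Quat u
  rw [Quaternion.normSq_def'] at h
  simp only [Quaternion.re_add, Quaternion.re_one, Quaternion.imI_add, Quaternion.imI_one, Quaternion.imJ_add,
    Quaternion.imJ_one, Quaternion.imK_add, Quaternion.imK_one, add_zero, u0_eq_re_su2Quat]
  nlinarith [h]

/-- **`ρ(u) := |q_u + 1| = √(2(1+u₀))`**, the argument of the Bessel function in (5.17). [cite: MullerSchiemann1987, (5.17) p.276] -/
theorem norm_su2Quat_add_one_eq (u : SU2) : ‖su2Quat u + 1‖ = Real.sqrt (2 * (1 + u0 u)) := by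
  rw [← norm_su2Quat_add_one_sq, Real.sqrt_sq (norm_nonneg _)]

/-- The direction `w ∈ G` of `q_u + 1` (`q_w = (q_u + 1)/|q_u + 1|`; junk `e₀` at `u = −e₀`). [cite: MullerSchiemann1987, (5.17) p.276] -/
noncomputable def dirW (u : SU2) : SU2 := quatToSU2 (su2Quat u + 1)

/-- **`(uv⁻¹)₀ + v₀ = ρ(u)·(vw⁻¹)₀`** with `ρ(u) = |q_u + 1| = √(2(1+u₀))` and `w = dirW u`: the integrand of (5.17) is
a class function of `vw⁻¹`. [cite: MullerSchiemann1987, (5.17) p.276] -/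
theorem u0_mul_inv_add_u0_eq (u v : SU2) :
    u0 (u * v⁻¹) + u0 v = ‖su2Quat u + 1‖ * u0 (v * (dirW u)⁻¹) := by
  rw [u0_mul_inv_add_u0]
  by_cases hp : su2Quat u + 1 = 0
  · rw [hp, zero_mul, Quaternion.re_zero, norm_zero, zero_mul]
  · have hw : su2Quat (dirW u) = ‖su2Quat u + 1‖⁻¹ • (su2Quat u + 1) := su2Quat_quatToSU2 hp
    have hn : ‖su2Quat u + 1‖ ≠ 0 := norm_ne_zero_iff.mpr hp
    rw [← u0_inv, mul_inv_rev, inv_inv, u0_mul_inv, hw, smul_mul_assoc, Quaternion.re_smul, smul_eq_mul,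
      ← mul_assoc, mul_inv_cancel₀ hn, one_mul]

/-- «trace(uv⁻¹) + trace v» of (5.17) is `2[(uv⁻¹)₀ + v₀]` (`tr u = 2u₀`, the sibling's `trace_val_eq`), so
`−β[4 − trace(uv⁻¹) − trace v] = −2β[2 − (uv⁻¹)₀ − v₀]` — the second line of (5.17) equals its first line without the
cut-offs. [cite: MullerSchiemann1987, (5.17) p.276] -/
theorem trace_add_trace (u v : SU2) :
    Matrix.trace ((u * v⁻¹ : SU2) : Matrix (Fin 2) (Fin 2) ℂ) + Matrix.trace (v : Matrix (Fin 2) (Fin 2) ℂ) =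
      2 * ((u0 (u * v⁻¹) + u0 v : ℝ) : ℂ) := by
  rw [trace_val_eq, trace_val_eq]; push_cast; ring

end OnSU2

/-! ## §3 The modified Bessel function `I₁` (p.276 last line – p.277 L.3, (5.21)) -/

section Bessel

/-- Integration by parts: `∫₀^π e^{x cos θ} cos θ dθ = x ∫₀^π e^{x cos θ} sin²θ dθ`
(`d/dθ[e^{x cos θ} sin θ] = −x e^{x cos θ} sin²θ + e^{x cos θ} cos θ`, boundary terms vanish). [cite: DLMF, 10.32.3] -/
theorem integral_exp_mul_cos_mul_cos_eq (x : ℝ) :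
    ∫ θ in (0:ℝ)..Real.pi, Real.exp (x * Real.cos θ) * Real.cos θ =
      x * ∫ θ in (0:ℝ)..Real.pi, Real.exp (x * Real.cos θ) * Real.sin θ ^ 2 := by
  have hderiv : ∀ θ ∈ uIcc (0:ℝ) Real.pi, HasDerivAt (fun θ => Real.exp (x * Real.cos θ) * Real.sin θ)
      (Real.exp (x * Real.cos θ) * (x * -Real.sin θ) * Real.sin θ + Real.exp (x * Real.cos θ) * Real.cos θ) θ := by
    intro θ _
    have h1 : HasDerivAt (fun θ => x * Real.cos θ) (x * -Real.sin θ) θ := (Real.hasDerivAt_cos θ).const_mul x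
    exact h1.exp.mul (Real.hasDerivAt_sin θ)
  have hint : IntervalIntegrable (fun θ => Real.exp (x * Real.cos θ) * (x * -Real.sin θ) * Real.sin θ +
      Real.exp (x * Real.cos θ) * Real.cos θ) volume 0 Real.pi := by
    apply Continuous.intervalIntegrable; fun_prop
  have h := intervalIntegral.integral_eq_sub_of_hasDerivAt hderiv hint
  simp only [Real.sin_pi, Real.sin_zero, mul_zero, sub_zero] at h
  have hA : IntervalIntegrable (fun θ => Real.exp (x * Real.cos θ) * Real.cos θ) volume 0 Real.pi := by
    apply Continuous.intervalIntegrable; fun_prop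
  have hB : IntervalIntegrable (fun θ => Real.exp (x * Real.cos θ) * (x * -Real.sin θ) * Real.sin θ)
      volume 0 Real.pi := by
    apply Continuous.intervalIntegrable; fun_prop
  rw [intervalIntegral.integral_add hB hA] at h
  have hB' : ∫ θ in (0:ℝ)..Real.pi, Real.exp (x * Real.cos θ) * (x * -Real.sin θ) * Real.sin θ =
      -(x * ∫ θ in (0:ℝ)..Real.pi, Real.exp (x * Real.cos θ) * Real.sin θ ^ 2) := by
    rw [← intervalIntegral.integral_const_mul, ← intervalIntegral.integral_neg]
    congr 1; funext θ; ring
  rw [hB'] at h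
  linarith

/-- **`I₁(x) = (x/π) ∫₀^π e^{x cos θ} sin²θ dθ`** for the tree's integral-defined `I₁` (DLMF 10.32.3 at `n = 1`,
integrated by parts). [cite: DLMF, 10.32.3] -/
theorem besselI_one_eq (x : ℝ) :
    besselI 1 x = x / Real.pi * ∫ θ in (0:ℝ)..Real.pi, Real.exp (x * Real.cos θ) * Real.sin θ ^ 2 := by
  rw [besselI]
  simp only [Nat.cast_one, one_mul]
  rw [integral_exp_mul_cos_mul_cos_eq]
  ring

/-- The Weyl-side identity: `(2/π)∫₀^π sin²θ e^{c cos θ} dθ = 2I₁(c)/c` (`c ≠ 0`). [cite: MullerSchiemann1987, (5.17) p.276] -/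
theorem weyl_exp_eq_besselI {c : ℝ} (hc : c ≠ 0) :
    2 / Real.pi * ∫ θ in (0:ℝ)..Real.pi, Real.sin θ ^ 2 * Real.exp (c * Real.cos θ) = 2 * besselI 1 c / c := by
  rw [besselI_one_eq]
  have hπ : Real.pi ≠ 0 := Real.pi_ne_zero
  simp_rw [mul_comm (Real.sin _ ^ 2) (Real.exp _)]
  field_simp

/-- Symmetrisation `θ ↦ π − θ`: `∫₀^π e^{x cos θ} sin²θ dθ = ∫₀^π cosh(x cos θ) sin²θ dθ` — the mechanism of
«x⁻¹I₁(x) increases monotonously». [cite: MullerSchiemann1987, p.277 L.1–2] -/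
theorem integral_exp_mul_cos_sin_sq_eq_cosh (x : ℝ) :
    ∫ θ in (0:ℝ)..Real.pi, Real.exp (x * Real.cos θ) * Real.sin θ ^ 2 =
      ∫ θ in (0:ℝ)..Real.pi, Real.cosh (x * Real.cos θ) * Real.sin θ ^ 2 := by
  have hrefl : ∫ θ in (0:ℝ)..Real.pi, Real.exp (x * Real.cos θ) * Real.sin θ ^ 2 =
      ∫ θ in (0:ℝ)..Real.pi, Real.exp (-(x * Real.cos θ)) * Real.sin θ ^ 2 := by
    have h := intervalIntegral.integral_comp_sub_left
      (fun θ => Real.exp (x * Real.cos θ) * Real.sin θ ^ 2) Real.pi (a := 0) (b := Real.pi)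
    simp only [sub_self, sub_zero, Real.cos_pi_sub, Real.sin_pi_sub, mul_neg] at h
    rw [← h]
  have hI1 : IntervalIntegrable (fun θ => Real.exp (x * Real.cos θ) * Real.sin θ ^ 2) volume 0 Real.pi := by
    apply Continuous.intervalIntegrable; fun_prop
  have hI2 : IntervalIntegrable (fun θ => Real.exp (-(x * Real.cos θ)) * Real.sin θ ^ 2) volume 0 Real.pi := by
    apply Continuous.intervalIntegrable; fun_prop
  have hsum : (∫ θ in (0:ℝ)..Real.pi, Real.exp (x * Real.cos θ) * Real.sin θ ^ 2) +
      (∫ θ in (0:ℝ)..Real.pi, Real.exp (-(x * Real.cos θ)) * Real.sin θ ^ 2) =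
      2 * ∫ θ in (0:ℝ)..Real.pi, Real.cosh (x * Real.cos θ) * Real.sin θ ^ 2 := by
    rw [← intervalIntegral.integral_add hI1 hI2, ← intervalIntegral.integral_const_mul]
    congr 1; funext θ
    rw [Real.cosh_eq]; ring
  linarith

/-- `x ↦ ∫₀^π e^{x cos θ} sin²θ dθ = π·x⁻¹I₁(x)` is monotone on `[0, ∞)` (`cosh` is monotone in `|·|`).
[cite: MullerSchiemann1987, p.277 L.1–2] -/
theorem monotoneOn_integral_exp_mul_cos_sin_sq :
    MonotoneOn (fun x : ℝ => ∫ θ in (0:ℝ)..Real.pi, Real.exp (x * Real.cos θ) * Real.sin θ ^ 2) (Ici 0) := by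
  intro x hx y hy hxy
  simp only [integral_exp_mul_cos_sin_sq_eq_cosh]
  refine intervalIntegral.integral_mono_on Real.pi_pos.le ?_ ?_ fun θ _ => ?_
  · apply Continuous.intervalIntegrable; fun_prop
  · apply Continuous.intervalIntegrable; fun_prop
  · refine mul_le_mul_of_nonneg_right ?_ (sq_nonneg _)
    rw [Real.cosh_le_cosh, abs_mul, abs_mul, abs_of_nonneg (show (0:ℝ) ≤ x from hx),
      abs_of_nonneg (show (0:ℝ) ≤ y from hy)]
    exact mul_le_mul_of_nonneg_right hxy (abs_nonneg _)

/-- **p.277 L.1–2: «x⁻¹I₁(x) increases monotonously with x ∈ ℝ₊»** (`x⁻¹I₁(x) = π⁻¹∫₀^π cosh(x cos θ) sin²θ dθ`).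
[cite: MullerSchiemann1987, p.277 L.1–2] -/
theorem monotoneOn_besselI_one_div : MonotoneOn (fun x : ℝ => besselI 1 x / x) (Ioi 0) := by
  intro x hx y hy hxy
  have hx0 : (0:ℝ) < x := hx
  have hy0 : (0:ℝ) < y := hy
  simp only [besselI_one_eq]
  rw [show x / Real.pi * (∫ θ in (0:ℝ)..Real.pi, Real.exp (x * Real.cos θ) * Real.sin θ ^ 2) / x =
      Real.pi⁻¹ * ∫ θ in (0:ℝ)..Real.pi, Real.exp (x * Real.cos θ) * Real.sin θ ^ 2 by field_simp,
    show y / Real.pi * (∫ θ in (0:ℝ)..Real.pi, Real.exp (y * Real.cos θ) * Real.sin θ ^ 2) / y =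
      Real.pi⁻¹ * ∫ θ in (0:ℝ)..Real.pi, Real.exp (y * Real.cos θ) * Real.sin θ ^ 2 by field_simp]
  exact mul_le_mul_of_nonneg_left (monotoneOn_integral_exp_mul_cos_sin_sq hx0.le hy0.le hxy)
    (inv_nonneg.mpr Real.pi_pos.le)

/-- **«the asymptotic expansion of the modified Bessel function»** in the form that yields the `β^{−3/2}` of (5.21):
`I₁(x) ≤ (1 + 50/x)·e^x/√(2πx)` for `x > 0` (`I₁ ≤ I₀`, tree `besselI_succ_le`, and the tree's Debye envelope
`besselI_mem_Icc_debye` of `I₀` after Fröhlich–Spencer). [cite: MullerSchiemann1987, (5.21) p.277] -/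
theorem besselI_one_le_envelope {x : ℝ} (hx : 0 < x) :
    besselI 1 x ≤ (1 + 50 / x) * (Real.exp x / Real.sqrt (2 * Real.pi * x)) := by
  have h1 : besselI 1 x ≤ besselI 0 x := Literature.Analysis.FunctionSpaces.besselI_succ_le 0 hx.le
  have h2 := (Probability.LatticeModels.besselI_mem_Icc_debye hx 0).2
  simp only [Int.cast_zero, zero_mul, sub_zero] at h2
  have hs : Real.sqrt (x ^ 2 + (0 : ℝ) ^ 2) = x := by
    rw [zero_pow two_ne_zero, add_zero, Real.sqrt_sq hx.le]
  rw [hs] at h2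
  rw [Literature.Analysis.FunctionSpaces.besselI_eq_latticeModels_besselI] at h1 ⊢
  rw [Literature.Analysis.FunctionSpaces.besselI_eq_latticeModels_besselI] at h1
  push_cast at h1 h2 ⊢
  exact h1.trans h2

/-- The same divided by `x`, in the scale-free form `2I₁(x)/x ≤ (4/√(2π))·e^x·x^{−3/2}` for `x ≥ 50` — with
`x = 2βρ̄`, `ρ̄ ≈ 2`, this is the «const β^{−3/2} e^{…}» of (5.21). [cite: MullerSchiemann1987, (5.21) p.277] -/
theorem two_mul_besselI_one_div_le {x : ℝ} (hx : 50 ≤ x) :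
    2 * besselI 1 x / x ≤ 4 / Real.sqrt (2 * Real.pi) * Real.exp x * x ^ (-(3/2 : ℝ)) := by
  have hx0 : 0 < x := by linarith
  have h := besselI_one_le_envelope hx0
  have h50 : 1 + 50 / x ≤ 2 := by
    have : 50 / x ≤ 1 := by rw [div_le_one hx0]; exact hx
    linarith
  have hsq : Real.sqrt (2 * Real.pi * x) = Real.sqrt (2 * Real.pi) * Real.sqrt x :=
    Real.sqrt_mul (by positivity) x
  have hsx : 0 < Real.sqrt x := Real.sqrt_pos.mpr hx0
  have hs2 : 0 < Real.sqrt (2 * Real.pi) := Real.sqrt_pos.mpr (by positivity)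
  -- x^{-3/2} = 1/(x √x)
  have hpow : x ^ (-(3/2 : ℝ)) = (x * Real.sqrt x)⁻¹ := by
    rw [Real.rpow_neg hx0.le, Real.sqrt_eq_rpow, ← Real.rpow_one_add' hx0.le (by norm_num)]
    norm_num
  rw [hpow]
  have hI : besselI 1 x ≤ 2 * (Real.exp x / (Real.sqrt (2 * Real.pi) * Real.sqrt x)) := by
    rw [← hsq]
    exact h.trans (mul_le_mul_of_nonneg_right h50 (by positivity))
  rw [div_le_iff₀ hx0]
  calc 2 * besselI 1 x ≤ 2 * (2 * (Real.exp x / (Real.sqrt (2 * Real.pi) * Real.sqrt x))) := by linarith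
    _ = 4 / Real.sqrt (2 * Real.pi) * Real.exp x * (x * Real.sqrt x)⁻¹ * x := by
        field_simp
        norm_num

end Bessel

/-! ## §4 (5.17) assembled; the replacement `u₀ ↦ sup u₀`; (5.18)–(5.21) -/

section Eq517

local notation "SU2" => Matrix.specialUnitaryGroup (Fin 2) ℂ

open HeatKernel (u0 u0_inv)

/-- `∫_{SU(2)} e^{c v₀} dv = 2I₁(c)/c` (`c ≠ 0`): Weyl's formula and `weyl_exp_eq_besselI`.
[cite: MullerSchiemann1987, (5.17) p.276] -/
theorem integral_exp_mul_u0 {c : ℝ} (hc : c ≠ 0) :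
    ∫ v, Real.exp (c * u0 v) ∂(haarProbability SU2) = 2 * besselI 1 c / c := by
  rw [integral_comp_u0 (fun t => Real.exp (c * t)) (by fun_prop)]
  exact weyl_exp_eq_besselI hc

/-- **(5.17), SECOND ⟶ THIRD LINE, AS AN IDENTITY**: for `u ∈ G` with `ρ := √(2(1+u₀)) = |q_u + 1| ≠ 0` and `β ≠ 0`,
`∫_G exp{−β[4 − 2(uv⁻¹)₀ − 2v₀]} dv = e^{−4β} · I₁(2βρ)/(βρ)` («< const exp{… − 4β} I₁(2β√(2(1+u₀)))/(β√(2(1+u₀)))»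
with const `= 1`; `4 − 2(uv⁻¹)₀ − 2v₀ = 4 − trace(uv⁻¹) − trace v` by `trace_add_trace`).
[cite: MullerSchiemann1987, (5.17) p.276] -/
theorem eq517 {β : ℝ} (hβ : β ≠ 0) (u : SU2) (hρ : su2Quat u + 1 ≠ 0) :
    ∫ v, Real.exp (-β * (4 - 2 * u0 (u * v⁻¹) - 2 * u0 v)) ∂(haarProbability SU2) =
      Real.exp (-4 * β) * (besselI 1 (2 * β * ‖su2Quat u + 1‖) / (β * ‖su2Quat u + 1‖)) := by
  have hn : ‖su2Quat u + 1‖ ≠ 0 := norm_ne_zero_iff.mpr hρ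
  have hc : 2 * β * ‖su2Quat u + 1‖ ≠ 0 := mul_ne_zero (mul_ne_zero two_ne_zero hβ) hn
  have h1 : (fun v : SU2 => Real.exp (-β * (4 - 2 * u0 (u * v⁻¹) - 2 * u0 v))) =
      fun v => Real.exp (-4 * β) * (fun t => Real.exp ((2 * β * ‖su2Quat u + 1‖) * t)) (u0 (v * (dirW u)⁻¹)) := by
    funext v
    have e := u0_mul_inv_add_u0_eq u v
    rw [← Real.exp_add]
    congr 1
    linear_combination (2 * β) * e
  rw [h1, integral_const_mul, integral_comp_u0_mul_inv (fun t => Real.exp ((2 * β * ‖su2Quat u + 1‖) * t)) (dirW u),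
    integral_exp_mul_u0 hc]
  congr 1
  field_simp

/-- **p.277 L.1–3, the replacement `u₀ ↦ sup(u₀)`**: for `0 < ρ ≤ ρ̄` and `β > 0`,
`I₁(2βρ)/(βρ) ≤ I₁(2βρ̄)/(βρ̄)` («Since x⁻¹I₁(x) increases monotonously … we can in (5.17) replace u₀ by sup(u₀)»;
`ρ = √(2(1+u₀))` is monotone in `u₀`). [cite: MullerSchiemann1987, p.277 L.1–3] -/
theorem eq517_mono {β ρ ρ' : ℝ} (hβ : 0 < β) (hρ : 0 < ρ) (hρρ' : ρ ≤ ρ') :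
    besselI 1 (2 * β * ρ) / (β * ρ) ≤ besselI 1 (2 * β * ρ') / (β * ρ') := by
  have hρ' : 0 < ρ' := lt_of_lt_of_le hρ hρρ'
  have h := monotoneOn_besselI_one_div (mem_Ioi.mpr (by positivity : (0:ℝ) < 2 * β * ρ))
    (mem_Ioi.mpr (by positivity : (0:ℝ) < 2 * β * ρ')) (by nlinarith)
  have e1 : besselI 1 (2 * β * ρ) / (β * ρ) = 2 * (besselI 1 (2 * β * ρ) / (2 * β * ρ)) := by field_simp
  have e2 : besselI 1 (2 * β * ρ') / (β * ρ') = 2 * (besselI 1 (2 * β * ρ') / (2 * β * ρ')) := by field_simp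
  rw [e1, e2]
  linarith

/-- `ρ = √(2(1+u₀))` is monotone in `u₀` (so `sup` over the region (5.4) is taken at `sup u₀`).
[cite: MullerSchiemann1987, p.277 L.1–3] -/
theorem sqrt_two_mul_one_add_mono {a b : ℝ} (h : a ≤ b) : Real.sqrt (2 * (1 + a)) ≤ Real.sqrt (2 * (1 + b)) :=
  Real.sqrt_le_sqrt (by linarith)

/-- **(5.18)–(5.19) exactly**: on the boundary `|θ²(u,iy)| = (β′)^{−2α}` the print evaluates
`|2(1−u₀) − y² − 2iyu₃|` with `u₀ = cos ψ`, `u₃ = sin ψ`; the exact modulus is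
`|2(1 − cos ψ) − y² − 2iy sin ψ|² = (2(1−cos ψ) + y²)² − 4y²(1−cos ψ)²`, of which (5.19)
`(ψ² + y²)² + 𝒪(β^{−6α})` is the Taylor truncation (`2(1 − cos ψ) = ψ² + 𝒪(ψ⁴)`, `(1−cos ψ)² = 𝒪(ψ⁴)`).
[cite: MullerSchiemann1987, (5.18)–(5.19) p.277] -/
theorem eq519_exact (ψ y : ℝ) :
    Complex.normSq (2 * (1 - Real.cos ψ) - y ^ 2 - 2 * Complex.I * y * Real.sin ψ) =
      (2 * (1 - Real.cos ψ) + y ^ 2) ^ 2 - 4 * y ^ 2 * (1 - Real.cos ψ) ^ 2 := by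
  have hs := Real.sin_sq_add_cos_sq ψ
  set w : ℂ := 2 * (1 - Real.cos ψ) - y ^ 2 - 2 * Complex.I * y * Real.sin ψ with hw
  have hw' : w = ⟨2 * (1 - Real.cos ψ) - y ^ 2, -(2 * y * Real.sin ψ)⟩ := by
    rw [hw]
    apply Complex.ext <;> simp [pow_two, Complex.cos_ofReal_re, Complex.sin_ofReal_re, Complex.cos_ofReal_im,
      Complex.sin_ofReal_im]
  rw [hw', Complex.normSq_mk]
  nlinarith [hs]

/-- `√(4 − ε) ≤ 2 − ε/4` (`ε ≤ 8`; concavity of `√` at `4`): with `2(1 + sup u₀) = 4 − ε` this turns (5.20) into the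
exponent `−4β + 2βρ̄ ≤ −βε/2` of (5.21). [cite: MullerSchiemann1987, (5.20)–(5.21) p.277] -/
theorem sqrt_four_sub_le {ε : ℝ} (hε : ε ≤ 8) : Real.sqrt (4 - ε) ≤ 2 - ε / 4 := by
  rw [Real.sqrt_le_left (by linarith)]
  nlinarith [sq_nonneg ε]

/-- **(5.20) ⟶ (5.21), the exponent**: with `sup u₀ = 1 − ½{(β′)^{−2α} − y²} + r` ((5.20), `r` = its `𝒪(β^{−4α})`),
`ρ̄ = √(2(1 + sup u₀))`, `β ≥ 0` and «the maximal value of |y| due to (5.4)» `y² ≤ (κ²/4)(β′)^{−2α}`: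
`(β/2)y² − 4β + 2βρ̄ ≤ (β/2)[y² − (1 − κ²/4)(β′)^{−2α}] + βr`
(print: `(β/2)[y² − p(β′)^{−2α} − (1 − κ²/4 − p)(β′)^{−2α}]`, the same number). Here `E′` stands for `(β′)^{−2α}`.
[cite: MullerSchiemann1987, (5.20)–(5.21) p.277] -/
theorem eq521_exponent {β y E' r κ ρbar : ℝ} (hβ : 0 ≤ β) (hE : E' - y ^ 2 - 2 * r ≤ 8)
    (hρ : ρbar = Real.sqrt (2 * (1 + (1 - (E' - y ^ 2) / 2 + r)))) (hy : y ^ 2 ≤ κ ^ 2 / 4 * E') :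
    β / 2 * y ^ 2 - 4 * β + 2 * β * ρbar ≤ β / 2 * (y ^ 2 - (1 - κ ^ 2 / 4) * E') + β * r := by
  have h1 : 2 * (1 + (1 - (E' - y ^ 2) / 2 + r)) = 4 - (E' - y ^ 2 - 2 * r) := by ring
  rw [h1] at hρ
  have h2 : ρbar ≤ 2 - (E' - y ^ 2 - 2 * r) / 4 := by rw [hρ]; exact sqrt_four_sub_le hE
  have h3 : 2 * β * ρbar ≤ 2 * β * (2 - (E' - y ^ 2 - 2 * r) / 4) := mul_le_mul_of_nonneg_left h2 (by linarith)
  have h4 : β / 2 * y ^ 2 ≤ β / 2 * (κ ^ 2 / 4 * E') := mul_le_mul_of_nonneg_left hy (by linarith)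
  linarith

end Eq517

/-! ## §5 (5.21)–(5.23) ⟹ (5.24) ⟹ (5.25): the exponent collection -/

section Exponents

/-- `β′^s ≤ β^s + c` for `β, β′ ≥ 0`, `β′ ≤ β + c`, `c ≥ 1`, `0 ≤ s ≤ 1` (sub-additivity of `t ↦ t^s`): how
«β′ = β + 𝒪(1)» is incorporated in the `β^{1−2α}`-terms. [cite: MullerSchiemann1987, (5.24) p.277] -/
theorem rpow_le_rpow_add {β β' c s : ℝ} (hβ : 0 ≤ β) (hβ' : 0 ≤ β') (hc : 1 ≤ c) (h : β' ≤ β + c)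
    (hs0 : 0 ≤ s) (hs1 : s ≤ 1) : β' ^ s ≤ β ^ s + c := by
  have hc0 : 0 ≤ c := le_trans zero_le_one hc
  calc β' ^ s ≤ (β + c) ^ s := Real.rpow_le_rpow hβ' h hs0
    _ ≤ β ^ s + c ^ s := Real.rpow_add_le_add_rpow hβ hc0 hs0 hs1
    _ ≤ β ^ s + c := by
        have : c ^ s ≤ c ^ (1:ℝ) := Real.rpow_le_rpow_of_exponent_le hc hs1
        rw [Real.rpow_one] at this
        linarith

/-- `β · β^{−t} = β^{1−t}` (`β > 0`). [folklore] -/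
private theorem mul_rpow_neg {β t : ℝ} (hβ : 0 < β) : β * β ^ (-t) = β ^ (1 - t) := by
  rw [sub_eq_add_neg, Real.rpow_add hβ, Real.rpow_one]

/-- The `y²`-term: `(β/2)y² ≤ (β′/2)y² + cκ²/8` when `|β − β′| ≤ c` and `y² ≤ κ²/4` (how «β′ = β + 𝒪(1)» is
incorporated in the `y²`-terms). [cite: MullerSchiemann1987, (5.24) p.277] -/
theorem yterm_le {β β' c κ y : ℝ} (hββ' : |β - β'| ≤ c) (hy0 : 0 ≤ y ^ 2) (hy1 : y ^ 2 ≤ κ ^ 2 / 4)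
    (hc : 0 ≤ c) : β / 2 * y ^ 2 ≤ β' / 2 * y ^ 2 + c * κ ^ 2 / 8 := by
  have h1 : (β - β') / 2 * y ^ 2 ≤ c / 2 * y ^ 2 :=
    mul_le_mul_of_nonneg_right (by linarith [(abs_le.mp hββ').2]) hy0
  have h2 : c / 2 * y ^ 2 ≤ c / 2 * (κ ^ 2 / 4) := mul_le_mul_of_nonneg_left hy1 (by linarith)
  linarith

/-- `|β − β′| ≤ c ⇒ β′ − c ≤ β`. [folklore] -/
private theorem sub_le_of_abs_sub_le {β β' c : ℝ} (h : |β - β'| ≤ c) : β' - c ≤ β := by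
  linarith [(abs_le.mp h).1]

/-- **(5.21)–(5.23) ⟹ (5.24), CONSTANTS EXPLICIT.**  Parameters: `¼ ≤ α < ½` (print: `3/7 ≤ α < ½`),
`½ < p < 1 − κ²/4` (so `δ₃ = 1 − κ²/4 − p > 0`); the step data: `β, β′ ≥ 1`, `|β − β′| ≤ c` with `c ≥ 1`
(«β′ = β + 𝒪(1)»), `y² ≤ (κ/2)²(β′)^{−2α}` ((5.4)); the printed bounds: (5.21) with const `C₁ ≥ 0`, (5.22) for `J⁽²⁾`
and `J⁽³⁾` with `𝒪(β^{−4α})` read as `Dβ^{−4α}` (`D ≥ 0`), (5.23); and (5.10) `J = Σ J⁽ᵏ⁾`.  CONCLUSION (5.24):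
`‖J‖ ≤ const · exp{½[β′y² − p(β′)^{1−2α} − δ₃(β′)^{1−2α}]}` with `const = (C₁ + 3)·exp{cκ²/8 + 2pc + D/2}`.
[cite: MullerSchiemann1987, (5.21)–(5.24) p.277] -/
theorem eq524 {α κ p c C₁ D β β' y : ℝ} {J J₁ J₂ J₃ J₄ : ℂ}
    (hα₁ : 1 / 4 ≤ α) (hα₂ : α < 1 / 2) (hp₁ : 1 / 2 < p) (hp₂ : p < 1 - κ ^ 2 / 4)
    (hc : 1 ≤ c) (hC₁ : 0 ≤ C₁) (hD : 0 ≤ D)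
    (hβ : 1 ≤ β) (hβ' : 1 ≤ β') (hββ' : |β - β'| ≤ c)
    (hy : y ^ 2 ≤ (κ / 2) ^ 2 * β' ^ (-(2 * α)))
    (hJ : J = J₁ + J₂ + J₃ + J₄)
    (h521 : ‖J₁‖ ≤ C₁ * β ^ (-(3/2 : ℝ)) *
      Real.exp (β / 2 * (y ^ 2 - p * β' ^ (-(2 * α)) - (1 - κ ^ 2 / 4 - p) * β' ^ (-(2 * α)))))
    (h522 : ‖J₂‖ ≤ Real.exp (β / 2 * (y ^ 2 - p * β ^ (-(2 * α)) - p * β ^ (-(2 * α)) + D * β ^ (-(4 * α)))))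
    (h522' : ‖J₃‖ ≤ Real.exp (β / 2 * (y ^ 2 - p * β ^ (-(2 * α)) - p * β ^ (-(2 * α)) + D * β ^ (-(4 * α)))))
    (h523 : ‖J₄‖ ≤ Real.exp (β / 2 * (y ^ 2 - p * β ^ (-(2 * α)) - 3 * p * β ^ (-(2 * α))))) :
    ‖J‖ ≤ (C₁ + 3) * Real.exp (c * κ ^ 2 / 8 + 2 * p * c + D / 2) *
      Real.exp (1 / 2 * (β' * y ^ 2 - p * β' ^ (1 - 2 * α) - (1 - κ ^ 2 / 4 - p) * β' ^ (1 - 2 * α))) := by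
  have hβ0 : 0 < β := by linarith
  have hβ'0 : 0 < β' := by linarith
  have hs0 : 0 ≤ 1 - 2 * α := by linarith
  have hs1 : 1 - 2 * α ≤ 1 := by linarith
  have hc0 : 0 ≤ c := le_trans zero_le_one hc
  have hp0 : 0 ≤ p := by linarith
  have hκ0 : 0 ≤ κ ^ 2 := sq_nonneg κ
  -- E' := β'^{-2α} ∈ (0,1]
  have hE'1 : β' ^ (-(2 * α)) ≤ 1 := Real.rpow_le_one_of_one_le_of_nonpos hβ' (by linarith)
  have hE'0 : 0 < β' ^ (-(2 * α)) := Real.rpow_pos_of_pos hβ'0 _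
  -- β^s, β'^s
  have hβs : β * β ^ (-(2 * α)) = β ^ (1 - 2 * α) := mul_rpow_neg hβ0
  have hβ's : β' * β' ^ (-(2 * α)) = β' ^ (1 - 2 * α) := mul_rpow_neg hβ'0
  have hle1 : β' ≤ β + c := by linarith [(abs_le.mp hββ').1, (abs_le.mp hββ').2]
  have hcmp : β' ^ (1 - 2 * α) ≤ β ^ (1 - 2 * α) + c := rpow_le_rpow_add hβ0.le hβ'0.le hc hle1 hs0 hs1
  have hβ's0 : 0 ≤ β' ^ (1 - 2 * α) := Real.rpow_nonneg hβ'0.le _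
  -- y² ≤ κ²/4 and the y-term
  have hy0 : 0 ≤ y ^ 2 := sq_nonneg y
  have hy1 : y ^ 2 ≤ κ ^ 2 / 4 := by
    have h := mul_le_of_le_one_right (sq_nonneg (κ / 2)) hE'1
    linarith only [hy, h]
  have hyterm : β / 2 * y ^ 2 ≤ β' / 2 * y ^ 2 + c * κ ^ 2 / 8 := yterm_le hββ' hy0 hy1 hc0
  -- β^{1-4α} ≤ 1
  have hF : β * β ^ (-(4 * α)) ≤ 1 := by
    rw [mul_rpow_neg hβ0]; exact Real.rpow_le_one_of_one_le_of_nonpos hβ (by linarith)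
  -- the three exponent comparisons against T + K,
  -- T := ½(β'y² − pβ'^s − δ₃β'^s), K := cκ²/8 + 2pc + D/2
  have e4 : β / 2 * (y ^ 2 - p * β ^ (-(2 * α)) - 3 * p * β ^ (-(2 * α))) ≤
      1 / 2 * (β' * y ^ 2 - p * β' ^ (1 - 2 * α) - (1 - κ ^ 2 / 4 - p) * β' ^ (1 - 2 * α)) +
        (c * κ ^ 2 / 8 + 2 * p * c + D / 2) := by
    have hr : β / 2 * (y ^ 2 - p * β ^ (-(2 * α)) - 3 * p * β ^ (-(2 * α))) =
        β / 2 * y ^ 2 - 2 * p * (β * β ^ (-(2 * α))) := by ring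
    rw [hr, hβs]
    have ha : 2 * p * β' ^ (1 - 2 * α) ≤ 2 * p * (β ^ (1 - 2 * α) + c) :=
      mul_le_mul_of_nonneg_left hcmp (by linarith)
    have hb : (1 / 2) * (p + (1 - κ ^ 2 / 4 - p)) * β' ^ (1 - 2 * α) ≤ 2 * p * β' ^ (1 - 2 * α) :=
      mul_le_mul_of_nonneg_right (by linarith) hβ's0
    linarith only [hyterm, ha, hb, hD]
  have e2 : β / 2 * (y ^ 2 - p * β ^ (-(2 * α)) - p * β ^ (-(2 * α)) + D * β ^ (-(4 * α))) ≤
      1 / 2 * (β' * y ^ 2 - p * β' ^ (1 - 2 * α) - (1 - κ ^ 2 / 4 - p) * β' ^ (1 - 2 * α)) +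
        (c * κ ^ 2 / 8 + 2 * p * c + D / 2) := by
    have hr : β / 2 * (y ^ 2 - p * β ^ (-(2 * α)) - p * β ^ (-(2 * α)) + D * β ^ (-(4 * α))) =
        β / 2 * y ^ 2 - p * (β * β ^ (-(2 * α))) + D / 2 * (β * β ^ (-(4 * α))) := by ring
    rw [hr, hβs]
    have ha : p * β' ^ (1 - 2 * α) ≤ p * (β ^ (1 - 2 * α) + c) := mul_le_mul_of_nonneg_left hcmp hp0
    have hb : (1 / 2) * (p + (1 - κ ^ 2 / 4 - p)) * β' ^ (1 - 2 * α) ≤ p * β' ^ (1 - 2 * α) :=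
      mul_le_mul_of_nonneg_right (by linarith) hβ's0
    have hd : D / 2 * (β * β ^ (-(4 * α))) ≤ D / 2 * 1 := mul_le_mul_of_nonneg_left hF (by linarith)
    have hpc : 0 ≤ p * c := mul_nonneg hp0 hc0
    linarith only [hyterm, ha, hb, hd, hpc]
  have e1 : β / 2 * (y ^ 2 - p * β' ^ (-(2 * α)) - (1 - κ ^ 2 / 4 - p) * β' ^ (-(2 * α))) ≤
      1 / 2 * (β' * y ^ 2 - p * β' ^ (1 - 2 * α) - (1 - κ ^ 2 / 4 - p) * β' ^ (1 - 2 * α)) +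
        (c * κ ^ 2 / 8 + 2 * p * c + D / 2) := by
    have hr : β / 2 * (y ^ 2 - p * β' ^ (-(2 * α)) - (1 - κ ^ 2 / 4 - p) * β' ^ (-(2 * α))) =
        β / 2 * y ^ 2 - (1 - κ ^ 2 / 4) / 2 * (β * β' ^ (-(2 * α))) := by ring
    rw [hr]
    -- β E' ≥ (β' − c) E' = β'^s − c E' ≥ β'^s − c
    have h1 : (β' - c) * β' ^ (-(2 * α)) ≤ β * β' ^ (-(2 * α)) :=
      mul_le_mul_of_nonneg_right (by linarith only [sub_le_of_abs_sub_le hββ']) hE'0.le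
    have h2 : (β' - c) * β' ^ (-(2 * α)) = β' ^ (1 - 2 * α) - c * β' ^ (-(2 * α)) := by rw [sub_mul, hβ's]
    have h3 : c * β' ^ (-(2 * α)) ≤ c := mul_le_of_le_one_right hc0 hE'1
    have h4 : β' ^ (1 - 2 * α) - c ≤ β * β' ^ (-(2 * α)) := by linarith only [h1, h2, h3]
    have h5 : (1 - κ ^ 2 / 4) / 2 * (β' ^ (1 - 2 * α) - c) ≤ (1 - κ ^ 2 / 4) / 2 * (β * β' ^ (-(2 * α))) :=
      mul_le_mul_of_nonneg_left h4 (by linarith)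
    have h6 : (1 - κ ^ 2 / 4) / 2 * c ≤ 2 * p * c := mul_le_mul_of_nonneg_right (by linarith) hc0
    linarith only [hyterm, h5, h6, hD]
  -- prefactor of J₁
  have hpre : C₁ * β ^ (-(3/2 : ℝ)) ≤ C₁ :=
    mul_le_of_le_one_right hC₁ (Real.rpow_le_one_of_one_le_of_nonpos hβ (by norm_num))
  -- assemble
  have hexp : ∀ {x T K : ℝ}, x ≤ T + K → Real.exp x ≤ Real.exp K * Real.exp T := by
    intro x T K hx; rw [← Real.exp_add, add_comm K T]; exact Real.exp_le_exp.mpr hx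
  have b1 := h521.trans (mul_le_mul hpre (hexp e1) (Real.exp_pos _).le hC₁)
  have b2 := h522.trans (hexp e2)
  have b3 := h522'.trans (hexp e2)
  have b4 := h523.trans (hexp e4)
  have htri : ‖J‖ ≤ ‖J₁‖ + ‖J₂‖ + ‖J₃‖ + ‖J₄‖ := by
    rw [hJ]
    have h12 : ‖J₁ + J₂‖ ≤ ‖J₁‖ + ‖J₂‖ := norm_add_le _ _
    have h123 : ‖J₁ + J₂ + J₃‖ ≤ ‖J₁ + J₂‖ + ‖J₃‖ := norm_add_le _ _
    have h1234 : ‖J₁ + J₂ + J₃ + J₄‖ ≤ ‖J₁ + J₂ + J₃‖ + ‖J₄‖ := norm_add_le _ _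
    linarith only [h12, h123, h1234]
  have hsum := add_le_add (add_le_add (add_le_add b1 b2) b3) b4
  refine htri.trans (hsum.trans (le_of_eq ?_))
  ring

/-- **(5.24) + (5.5) ⟹ (5.25): «Hence due to δ₃ > 0 and β′ sufficiently large, (5.24) and (5.5) imply for the
analytically continued Gibbs factor (5.1) the bound |g̃′(u,iy)| < exp{β′y² − p(β′)^{1−2α}}».**  With the (5.24)-constant
`C₂₄ > 0`, (5.5) in the form `M ≥ mβ^{−3/2}` (`m > 0`), `g̃′ = (J/M)²` ((5.1)) and «β′ = β + 𝒪(1)» as `|β − β′| ≤ c`: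
for all sufficiently large `β′` (`∀ᶠ β′ in atTop`; the threshold depends on `α, κ, p, c, C₂₄, m` only), every
`β ≥ 1`, `y`, `M`, `J` with these properties satisfy `‖(J/M)²‖ < exp{β′y² − p(β′)^{1−2α}}` — the polynomial prefactor
`(C₂₄/m)²β³` is beaten by `exp{−δ₃(β′)^{1−2α}}` since `log β′ = o((β′)^{1−2α})` (`α < ½`).
[cite: MullerSchiemann1987, (5.25) p.277] -/
theorem eq525 {α κ p c C₂₄ m : ℝ} (hα₂ : α < 1 / 2) (hδ₃ : 0 < 1 - κ ^ 2 / 4 - p)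
    (hC : 0 < C₂₄) (hm : 0 < m) :
    ∀ᶠ β' : ℝ in atTop, ∀ (β y M : ℝ) (J : ℂ), 1 ≤ β → |β - β'| ≤ c →
      m * β ^ (-(3/2 : ℝ)) ≤ M →
      ‖J‖ ≤ C₂₄ * Real.exp (1 / 2 * (β' * y ^ 2 - p * β' ^ (1 - 2 * α) -
        (1 - κ ^ 2 / 4 - p) * β' ^ (1 - 2 * α))) →
      ‖(J / M) ^ 2‖ < Real.exp (β' * y ^ 2 - p * β' ^ (1 - 2 * α)) := by
  have hs0 : 0 < 1 - 2 * α := by linarith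
  have hlo := (isLittleO_log_rpow_atTop hs0).def (show (0:ℝ) < (1 - κ ^ 2 / 4 - p) / 8 by positivity)
  have hev1 : ∀ᶠ β' : ℝ in atTop, 1 ≤ β' := eventually_ge_atTop 1
  have hev3 : ∀ᶠ β' : ℝ in atTop,
      2 * Real.log (C₂₄ / m) + 3 * Real.log 2 ≤ (1 - κ ^ 2 / 4 - p) / 4 * β' ^ (1 - 2 * α) := by
    have ht : Tendsto (fun β' : ℝ => (1 - κ ^ 2 / 4 - p) / 4 * β' ^ (1 - 2 * α)) atTop atTop :=
      (tendsto_rpow_atTop hs0).const_mul_atTop (by positivity)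
    exact ht.eventually_ge_atTop _
  filter_upwards [hlo, hev1, eventually_ge_atTop c, hev3] with β' hlo' h1 h2 h3
  intro β y M J hβ hββ' hM hJ
  have hβ'0 : 0 < β' := by linarith
  have hβ0 : 0 < β := by linarith
  have hβle : β ≤ 2 * β' := by linarith [(abs_le.mp hββ').2]
  have hM0 : 0 < M := lt_of_lt_of_le (mul_pos hm (Real.rpow_pos_of_pos hβ0 _)) hM
  have hlog : Real.log β' ≤ (1 - κ ^ 2 / 4 - p) / 8 * β' ^ (1 - 2 * α) := by
    have := hlo'
    rw [Real.norm_eq_abs, Real.norm_eq_abs, abs_of_nonneg (Real.log_nonneg h1),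
      abs_of_nonneg (Real.rpow_nonneg hβ'0.le _)] at this
    exact this
  have hlogβ : Real.log β ≤ Real.log 2 + Real.log β' := by
    rw [← Real.log_mul (by norm_num) hβ'0.ne']; exact Real.log_le_log hβ0 hβle
  set S := β' ^ (1 - 2 * α) with hS
  have hS0 : 0 < S := Real.rpow_pos_of_pos hβ'0 _
  have hδS : 0 < (1 - κ ^ 2 / 4 - p) * S := mul_pos hδ₃ hS0
  set T : ℝ := 1 / 2 * (β' * y ^ 2 - p * S - (1 - κ ^ 2 / 4 - p) * S) with hT
  have hCm : 0 < C₂₄ / m := div_pos hC hm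
  have hβ32 : 0 < β ^ (3/2:ℝ) := Real.rpow_pos_of_pos hβ0 _
  have hMinv : m * (β ^ (3/2:ℝ))⁻¹ ≤ M := by rwa [Real.rpow_neg hβ0.le] at hM
  have hdiv : ‖J‖ / M ≤ C₂₄ / m * β ^ (3/2:ℝ) * Real.exp T := by
    rw [div_le_iff₀ hM0]
    calc ‖J‖ ≤ C₂₄ * Real.exp T := hJ
      _ = C₂₄ / m * β ^ (3/2:ℝ) * Real.exp T * (m * (β ^ (3/2:ℝ))⁻¹) := by
          field_simp
      _ ≤ C₂₄ / m * β ^ (3/2:ℝ) * Real.exp T * M := mul_le_mul_of_nonneg_left hMinv (by positivity)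
  have hdiv0 : 0 ≤ ‖J‖ / M := div_nonneg (norm_nonneg _) hM0.le
  rw [norm_pow, norm_div, Complex.norm_real, Real.norm_eq_abs, abs_of_pos hM0]
  have hsq : (‖J‖ / M) ^ 2 ≤ (C₂₄ / m * β ^ (3/2:ℝ) * Real.exp T) ^ 2 := pow_le_pow_left₀ hdiv0 hdiv 2
  have hR : (C₂₄ / m * β ^ (3/2:ℝ) * Real.exp T) ^ 2 =
      Real.exp (2 * Real.log (C₂₄ / m) + 3 * Real.log β + 2 * T) := by
    have e1 : Real.exp (2 * Real.log (C₂₄ / m)) = (C₂₄ / m) ^ 2 := by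
      rw [show (2:ℝ) * Real.log (C₂₄ / m) = ((2:ℕ):ℝ) * Real.log (C₂₄ / m) by norm_num,
        Real.exp_nat_mul, Real.exp_log hCm]
    have e2 : (β ^ (3/2:ℝ)) ^ 2 = Real.exp (3 * Real.log β) := by
      rw [← Real.rpow_natCast, ← Real.rpow_mul hβ0.le, Real.rpow_def_of_pos hβ0]
      congr 1; push_cast; ring
    have e3 : Real.exp (2 * T) = (Real.exp T) ^ 2 := by
      rw [show (2:ℝ) * T = ((2:ℕ):ℝ) * T by norm_num, Real.exp_nat_mul]
    rw [Real.exp_add, Real.exp_add, e1, ← e2, e3]; ring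
  rw [hR] at hsq
  refine lt_of_le_of_lt hsq (Real.exp_lt_exp.mpr ?_)
  rw [hT]
  linarith

end Exponents

end NonperturbativeBound

end MullerSchiemann1987

end Literature.MathematicalPhysics.QuantumFieldTheory
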